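import Summits.BirchSwinnertonDyer.BirchSwinnertonDyer.Theorems.SignedLowerHalvesSmallImageLowerHalfBothSignsRttSplitCloser
import Summits.BirchSwinnertonDyer.BirchSwinnertonDyer.Theorems.EisensteinPrimesMazurMCOnCellBKernelCertP13TwoUnits
import Summits.BirchSwinnertonDyer.BirchSwinnertonDyer.Theorems.Rank1ResidualIntModelReduction
import Literature.NumberTheory.EllipticCurves.SupersingularIrreducibleProofs
import Summits.BirchSwinnertonDyer.BirchSwinnertonDyer.Theorems.SignedLowerHalvesKobayashiMainConjectureSmallImageLambdaTransferCM25RecordsB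
import Summits.BirchSwinnertonDyer.BirchSwinnertonDyer.Theorems.SignedLowerHalvesKobayashiMainConjectureSmallImageLambdaTransferCM25RecordsC
import Summits.BirchSwinnertonDyer.BirchSwinnertonDyer.Theorems.SignedLowerHalvesKobayashiMainConjectureSmallImageLambdaTransferCM25RecordsE
import HarnessLib

/-!
# Route `SignedLowerHalves`, crux L `SmallImageLowerHalfBothSigns` (item stmt-BirchSwinnertonDyer-23599), line `rtt_w3`:
# SPLIT-CLOSER RECORDS, part 01 — crux L's body at the tier-T2 pairs 207616g1 @ 5, 207616h1 @ 5, 249777l1 @ 5, 269059r1 @ 5, 301824bp1 @ 5 from print + TWO displayed two-engine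
# Mazur–Tate rows `(μ, λ)(L^±_p) = (0, 2)` + a kernel split-multiplicative certificate — NO partner, NO floor binder

Width seat `bsd-line-slh-p3-w3` g14 under LEAD `cruxlead-stmt-BirchSwinnertonDyer-23599` g3 (cell `bsd-ssimc`); `--supports
stmt-BirchSwinnertonDyer-23599 --as helper`; THEOREMS ONLY; PER PAIR; closes nothing class-wide; BSD is proved for no curve (every
published input is a named-fact HYPOTHESIS).

WHAT IS RECORDED. The LEAD's tier T2 (pairs WITHOUT a CM elliptic-curve partner) at `p ≥ 5` consists of 10 pairs (6 @5, 3 @7, 1 @11 after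
g13's unit-zone records), carried on the board as «research residue ENG_T3 / PSB_T3». NINE of them are rank-`0` pairs with
`(μ, λ)(L^±_p) = (0, 2)` at BOTH signs — TWO-ENGINE rows of the crux's standing disprover (kit j335262 `cdisprove-…-23599`, PREREG `gvkan2`
839c353487edc3e8; `gvkan2/LAYERS.tsv` sha16 09c04126f37ca31c, engines B = `msengine (lit-g7)+iwlayer` and E = `eclib`, status `2eng`, AGREE;
evidence #53–#56 on the item): at the EVEN layer `n = 2` (`deg ω_2^− = deg Φ_p(1+T) = p − 1`) `μ(θ_2) = 0, λ(θ_2) = (p − 1) + 2`, and at the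
ODD layer `n = 1` (`deg ω_1^+ = 0`) `μ(θ_1) = 0, λ(θ_1) = 2` — and each has exactly ONE multiplicative prime `q`, with `ord_q(Δ) = p` and
SPLIT reduction (Cremona `∏c` = 10, 10, 10, 30, 20; kernel certificate below: a root of the node-tangent quadratic mod `q`). There crux L's body is the
SPLIT CLOSER `classX7_and_forall_kobayashiLowerDivisibility_of_split_of_mazurTateRows` (file `…RttSplitCloser`, this seat; mechanism = w3
g5's general-`p` λ-two closer `…LambdaLowerThreeNsTamagawa.forall_kobayashiLowerDivisibility_of_certs_of_finite_of_afe_of_not_surj_of_split`):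
PRINT BY NAME `hJ h12 h41` (Kobayashi), `hK13` (B. D. Kim 2013 Cor 3.15), `hK08` (B. D. Kim 2008 Thm 3.12, the AFE at `p > 3`), `h5 h3`,
`hmod` (modularity), `hGZK` (finiteness of `Sel_{p^∞}` at `r_an = 0`); displayed per pair: `r_an = 0` (Cremona), the two rows (`hrowE`,
`hrowO`), and `¬ Surj W p` (`hs` — crux L's own premise; k3-c4 census image `pNn`; the tree has no partner-free `pNn` certificate at
`p ≥ 5`). Kernel-decided per pair: `p ∤ Δ`, `#Ẽ(𝔽_p) = p + 1` (`a_p = 0`), an additive prime (X7), `q ∣ Δ`, `q ∤ c₄`, the node-tangent root.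
The tenth T2 pair at `p ≥ 5`, `431433o1 @ 5`, has rows `(0, 4)`, `(0, 6)` and is NOT reached by the λ-two closer.

References: [Kobayashi2003] Conjecture (p. 2), Thm. 1.2, 4.1, 6.2–7.3; [KimBD2008MRL] Thm. 3.12 (p. 93); [BDKim2013] Cor. 3.15;
[Pollack2003] Prop. 6.9, 6.10, 6.18; [Serre1972] §2.4 Prop. 15; [SilvermanAEC2009] VII.5 Prop. 5.1; [Darmon2004] Thm. 3.22;
[Cremona2006] Table 1 (labels 207616g1 @ 5, 207616h1 @ 5, 249777l1 @ 5, 269059r1 @ 5, 301824bp1 @ 5).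
-/

set_option autoImplicit false
-- D-0017: single-problem summit, the namespace repeats the problem name by design.
set_option linter.dupNamespace false
noncomputable section

open scoped Classical MatrixGroups ModularForm

open CongruenceSubgroup WeierstrassCurve Literature.NumberTheory.EllipticCurves
  Literature.NumberTheory.EllipticCurves.ModularForms
  Literature.NumberTheory.EllipticCurves.Kobayashi2003 ZpExtension
  Literature.NumberTheory.EllipticCurves.GreenbergVatsal2000
  Literature.NumberTheory.EllipticCurves.Rank1Residual
  Literature.NumberTheory.EllipticCurves.Rank1Residual.Typed
  Literature.NumberTheory.EllipticCurves.Rank1Residual.X11RankOneCertificates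
  Summit.BirchSwinnertonDyer.BirchSwinnertonDyer.Rank1Residual.IntModel
  Summit.BirchSwinnertonDyer.BirchSwinnertonDyer.Rank1Residual.X11RankOne
  Summit.BirchSwinnertonDyer.Rank1Residual.X11b
  Summit.BirchSwinnertonDyer.Rank1Residual.X9
  Summit.BirchSwinnertonDyer.Rank1Residual.X1
  Summit.BirchSwinnertonDyer.Rank1Residual.X1.MuLambda
  Summit.BirchSwinnertonDyer.Rank1Residual.Supersingular

namespace Summit.BirchSwinnertonDyer.BirchSwinnertonDyer.Theorems.SmallImageRttOneSided

/-! ### §1 Kernel point counts (`a_p = 0`; the counts of 207616g1/h1, 301824bp1 are k3-c4 g9`s `card_lam25_…`, imported) -/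

/-- `#{Ẽ(𝔽_5)} = 6` for the Cremona model of `249777l1` = `[0, 0, 1, -151455690, -716756974018]` (`a_5 = 0`: good SUPERSINGULAR; kernel count). [cite: Cremona2006, Table 1 (Cremona label 249777l1)] -/
theorem card_t249777l1_5 :
    Nat.card (((⟨0, 0, 1, -151455690, -716756974018⟩ : WeierstrassCurve ℤ).map
      (Int.castRingHom (ZMod 5))).toAffine.Point) = 6 := by
  rw [@WeierstrassCurve.natCard_point_eq_one_add_card (ZMod 5) (@ZMod.instField 5 ⟨by norm_num⟩) _ _ _
    (by decide +kernel), @card_sol_eq_sum_euler (ZMod 5) (@ZMod.instField 5 ⟨by norm_num⟩) _ _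
    (by rw [ZMod.ringChar_zmod_n]; decide), ZMod.card]
  decide +kernel

/-- `#{Ẽ(𝔽_5)} = 6` for the Cremona model of `269059r1` = `[0, 0, 1, -16163770, -25012514116]` (`a_5 = 0`: good SUPERSINGULAR; kernel count). [cite: Cremona2006, Table 1 (Cremona label 269059r1)] -/
theorem card_t269059r1_5 :
    Nat.card (((⟨0, 0, 1, -16163770, -25012514116⟩ : WeierstrassCurve ℤ).map
      (Int.castRingHom (ZMod 5))).toAffine.Point) = 6 := by
  rw [@WeierstrassCurve.natCard_point_eq_one_add_card (ZMod 5) (@ZMod.instField 5 ⟨by norm_num⟩) _ _ _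
    (by decide +kernel), @card_sol_eq_sum_euler (ZMod 5) (@ZMod.instField 5 ⟨by norm_num⟩) _ _
    (by rw [ZMod.ringChar_zmod_n]; decide), ZMod.card]
  decide +kernel

/-! ### §2 The split-closer records -/

/-- **Crux L's body at the tier-T2 pair `207616g1 @ 5` by the SPLIT CLOSER — NO partner** (Cremona model `[0, 0, 0, -158470, 31707704]`, `N = 207616 = 2⁸·811`, X7 (additive at
`2`), `a_5 = 0`, mod-`5` image `5Nn` (k3-c4 census; no CM elliptic-curve partner), analytic rank `0`, `#tors = 1`, `∏c = 10`, `#Ш_an = 1`,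
`L(E,1)/Ω_E = 10`; ONE multiplicative prime `q = 811`, `ord_q(Δ) = 5`, SPLIT): `ClassX7 W 5 ∧ ∀ ε, KobayashiLowerDivisibility W 5 ε` from print BY NAME
(`hJ h12 h41 hK13 hK08 h5 h3 hmod hGZK`) + displayed `r_an = 0` (`hr`), `¬ Surj W 5` (`hs`) and TWO displayed two-engine Mazur–Tate rows of kit
j335262 (`LAYERS.tsv` rows `207616g1@5`: index 2, even, `μ = 0, λ = 6 = 4 + 2` ⇒ `hrowE`; index 1, odd, `μ = 0, λ = 2 = 0 + 2` ⇒ `hrowO`;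
engines B and E AGREE) ⇒ `(μ, λ)(L^±_5) = (0, 2)`. Kernel-decided: `5 ∤ Δ`, `#Ẽ(𝔽_5) = 6` (`SmallImageCongruenceRoad.card_lam25_207616g1_5`), `2 ∣ Δ, c₄` (X7), and the split
certificate at `q = 811`: `q ∣ Δ`, `q ∤ c₄`, node-tangent root `t = 98` (`hasSplitMultiplicativeReductionAtPrime_of_natRoot`). Per pair;
CONDITIONAL; nothing booked. [cite: Kobayashi2003, Conjecture (p. 2), Thm. 1.2, Thm. 4.1] [cite: KimBD2008MRL, Thm. 3.12 (p. 93)]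
[cite: BDKim2013, Cor. 3.15 (p. 199)] [cite: Pollack2003, Prop. 6.18] [cite: SilvermanAEC2009, VII.5 Prop. 5.1(b)]
[cite: Cremona2006, Table 1 (Cremona label 207616g1)] -/
theorem forall_kobayashiLowerDivisibility_t207616g1_5_of_split_of_mazurTateRows
    (hJ : thm62_63_73_signedColemanKato_zetaJoint) (h12 : thm12_signedSelmerDual_finite_torsion)
    (h41 : thm41_signedCharIdeal_divisibility) (hK13 : BDKim2013.cor315_signedCharValue_rankZero)
    (hK08 : Kim2008.thm312_signedSelmerDual_charIdeal_map_invol)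
    (h5 : realPeriodRat_eq_unit_mul_plusPeriod) (h3 : realPeriodRat_eq_unit_mul_plusPeriod_three)
    (hmod : exists_isNewformOf) (hGZK : rank_eq_analyticRank_of_analyticRank_le_one)
    (W : WeierstrassCurve ℚ) [W.IsElliptic] [W.IsGloballyMinimal] [Fact (Nat.Prime 5)] (hW : W = ⟨0, 0, 0, -158470, 31707704⟩)
    (hs : ¬ Surj W 5) (hr : W.analyticRank = 0)
    (hrowE : ∀ [NeZero (W.conductorNorm ℤ)] (f : CuspForm (Gamma0 (W.conductorNorm ℤ)) 2), IsNewformOf W f →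
      ∃ Θ : IwasawaAlgebra 5, iwasawaToPowerSeries 5 Θ =
          ((mazurTateElement f 5 2).map (algebraMap ℚ ℚ_[5]) : PowerSeries ℚ_[5]) ∧
        Θ ≠ 0 ∧ mu Θ = 0 ∧ lam Θ = (cyclotomicOmegaMinus 5 2).natDegree + 2)
    (hrowO : ∀ [NeZero (W.conductorNorm ℤ)] (f : CuspForm (Gamma0 (W.conductorNorm ℤ)) 2), IsNewformOf W f →
      ∃ Θ : IwasawaAlgebra 5, iwasawaToPowerSeries 5 Θ =
          ((mazurTateElement f 5 1).map (algebraMap ℚ ℚ_[5]) : PowerSeries ℚ_[5]) ∧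
        Θ ≠ 0 ∧ mu Θ = 0 ∧ lam Θ = (cyclotomicOmegaPlus 5 1).natDegree + 2) :
    ClassX7 W 5 ∧ ∀ ε : ℤˣ, KobayashiLowerDivisibility W 5 ε := by
  have hIW : integralModelInt W = ⟨0, 0, 0, -158470, 31707704⟩ :=
    integralModelInt_eq_of_map_eq _ (by rw [hW]; ext <;> simp [WeierstrassCurve.map])
  have hΔ : (⟨0, 0, 0, -158470, 31707704⟩ : WeierstrassCurve ℤ).Δ = discOf [0, 0, 0, -158470, 31707704] :=
    intCurve_Δ 0 0 0 (-158470) 31707704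
  have hc₄ : (⟨0, 0, 0, -158470, 31707704⟩ : WeierstrassCurve ℤ).c₄ = c4Of [0, 0, 0, -158470, 31707704] :=
    intCurve_c₄ 0 0 0 (-158470) 31707704
  have hgood : W.HasGoodReductionAtPrime 5 :=
    hasGoodReductionAtPrime_of_not_dvd W 5 (by rw [minimalDiscriminantInt_eq hIW, hΔ]; decide +kernel)
  have hap : W.frobeniusTrace 5 = 0 := by rw [frobeniusTrace_eq hIW SmallImageCongruenceRoad.card_lam25_207616g1_5]; norm_num
  have hX : ClassX7 W 5 :=
    ⟨⟨hgood, by rw [hap]; exact dvd_zero _⟩, not_semistable_of_intModel hIW 2 (by norm_num) (by rw [hΔ]; decide +kernel)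
      (by rw [hc₄]; decide +kernel)⟩
  haveI : Fact (Nat.Prime 811) := ⟨by norm_num⟩
  have hsplit : W.HasSplitMultiplicativeReductionAtPrime 811 :=
    EisensteinPrimesMazurMCOnCellBKernelCertP13TwoUnits.hasSplitMultiplicativeReductionAtPrime_of_natRoot W hIW 811
      (by decide +kernel) (by decide +kernel) 98 (by decide +kernel)
  exact classX7_and_forall_kobayashiLowerDivisibility_of_split_of_mazurTateRows W 5 hJ h12 h41 hK13 hK08 h5 h3 hmod hGZK
    (by norm_num) hX hap hs hr (by decide) hrowE (by decide) hrowO hsplit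

/-- **Crux L's body at the tier-T2 pair `207616h1 @ 5` by the SPLIT CLOSER — NO partner** (Cremona model `[0, 0, 0, -633880, -253661632]`, `N = 207616 = 2⁸·811`, X7 (additive at
`2`), `a_5 = 0`, mod-`5` image `5Nn` (k3-c4 census; no CM elliptic-curve partner), analytic rank `0`, `#tors = 1`, `∏c = 10`, `#Ш_an = 9`,
`L(E,1)/Ω_E = 90`; ONE multiplicative prime `q = 811`, `ord_q(Δ) = 5`, SPLIT): `ClassX7 W 5 ∧ ∀ ε, KobayashiLowerDivisibility W 5 ε` from print BY NAME
(`hJ h12 h41 hK13 hK08 h5 h3 hmod hGZK`) + displayed `r_an = 0` (`hr`), `¬ Surj W 5` (`hs`) and TWO displayed two-engine Mazur–Tate rows of kit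
j335262 (`LAYERS.tsv` rows `207616h1@5`: index 2, even, `μ = 0, λ = 6 = 4 + 2` ⇒ `hrowE`; index 1, odd, `μ = 0, λ = 2 = 0 + 2` ⇒ `hrowO`;
engines B and E AGREE) ⇒ `(μ, λ)(L^±_5) = (0, 2)`. Kernel-decided: `5 ∤ Δ`, `#Ẽ(𝔽_5) = 6` (`SmallImageCongruenceRoad.card_lam25_207616h1_5`), `2 ∣ Δ, c₄` (X7), and the split
certificate at `q = 811`: `q ∣ Δ`, `q ∤ c₄`, node-tangent root `t = 16` (`hasSplitMultiplicativeReductionAtPrime_of_natRoot`). Per pair;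
CONDITIONAL; nothing booked. [cite: Kobayashi2003, Conjecture (p. 2), Thm. 1.2, Thm. 4.1] [cite: KimBD2008MRL, Thm. 3.12 (p. 93)]
[cite: BDKim2013, Cor. 3.15 (p. 199)] [cite: Pollack2003, Prop. 6.18] [cite: SilvermanAEC2009, VII.5 Prop. 5.1(b)]
[cite: Cremona2006, Table 1 (Cremona label 207616h1)] -/
theorem forall_kobayashiLowerDivisibility_t207616h1_5_of_split_of_mazurTateRows
    (hJ : thm62_63_73_signedColemanKato_zetaJoint) (h12 : thm12_signedSelmerDual_finite_torsion)
    (h41 : thm41_signedCharIdeal_divisibility) (hK13 : BDKim2013.cor315_signedCharValue_rankZero)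
    (hK08 : Kim2008.thm312_signedSelmerDual_charIdeal_map_invol)
    (h5 : realPeriodRat_eq_unit_mul_plusPeriod) (h3 : realPeriodRat_eq_unit_mul_plusPeriod_three)
    (hmod : exists_isNewformOf) (hGZK : rank_eq_analyticRank_of_analyticRank_le_one)
    (W : WeierstrassCurve ℚ) [W.IsElliptic] [W.IsGloballyMinimal] [Fact (Nat.Prime 5)] (hW : W = ⟨0, 0, 0, -633880, -253661632⟩)
    (hs : ¬ Surj W 5) (hr : W.analyticRank = 0)
    (hrowE : ∀ [NeZero (W.conductorNorm ℤ)] (f : CuspForm (Gamma0 (W.conductorNorm ℤ)) 2), IsNewformOf W f →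
      ∃ Θ : IwasawaAlgebra 5, iwasawaToPowerSeries 5 Θ =
          ((mazurTateElement f 5 2).map (algebraMap ℚ ℚ_[5]) : PowerSeries ℚ_[5]) ∧
        Θ ≠ 0 ∧ mu Θ = 0 ∧ lam Θ = (cyclotomicOmegaMinus 5 2).natDegree + 2)
    (hrowO : ∀ [NeZero (W.conductorNorm ℤ)] (f : CuspForm (Gamma0 (W.conductorNorm ℤ)) 2), IsNewformOf W f →
      ∃ Θ : IwasawaAlgebra 5, iwasawaToPowerSeries 5 Θ =
          ((mazurTateElement f 5 1).map (algebraMap ℚ ℚ_[5]) : PowerSeries ℚ_[5]) ∧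
        Θ ≠ 0 ∧ mu Θ = 0 ∧ lam Θ = (cyclotomicOmegaPlus 5 1).natDegree + 2) :
    ClassX7 W 5 ∧ ∀ ε : ℤˣ, KobayashiLowerDivisibility W 5 ε := by
  have hIW : integralModelInt W = ⟨0, 0, 0, -633880, -253661632⟩ :=
    integralModelInt_eq_of_map_eq _ (by rw [hW]; ext <;> simp [WeierstrassCurve.map])
  have hΔ : (⟨0, 0, 0, -633880, -253661632⟩ : WeierstrassCurve ℤ).Δ = discOf [0, 0, 0, -633880, -253661632] :=
    intCurve_Δ 0 0 0 (-633880) (-253661632)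
  have hc₄ : (⟨0, 0, 0, -633880, -253661632⟩ : WeierstrassCurve ℤ).c₄ = c4Of [0, 0, 0, -633880, -253661632] :=
    intCurve_c₄ 0 0 0 (-633880) (-253661632)
  have hgood : W.HasGoodReductionAtPrime 5 :=
    hasGoodReductionAtPrime_of_not_dvd W 5 (by rw [minimalDiscriminantInt_eq hIW, hΔ]; decide +kernel)
  have hap : W.frobeniusTrace 5 = 0 := by rw [frobeniusTrace_eq hIW SmallImageCongruenceRoad.card_lam25_207616h1_5]; norm_num
  have hX : ClassX7 W 5 :=
    ⟨⟨hgood, by rw [hap]; exact dvd_zero _⟩, not_semistable_of_intModel hIW 2 (by norm_num) (by rw [hΔ]; decide +kernel)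
      (by rw [hc₄]; decide +kernel)⟩
  haveI : Fact (Nat.Prime 811) := ⟨by norm_num⟩
  have hsplit : W.HasSplitMultiplicativeReductionAtPrime 811 :=
    EisensteinPrimesMazurMCOnCellBKernelCertP13TwoUnits.hasSplitMultiplicativeReductionAtPrime_of_natRoot W hIW 811
      (by decide +kernel) (by decide +kernel) 16 (by decide +kernel)
  exact classX7_and_forall_kobayashiLowerDivisibility_of_split_of_mazurTateRows W 5 hJ h12 h41 hK13 hK08 h5 h3 hmod hGZK
    (by norm_num) hX hap hs hr (by decide) hrowE (by decide) hrowO hsplit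

/-- **Crux L's body at the tier-T2 pair `249777l1 @ 5` by the SPLIT CLOSER — NO partner** (Cremona model `[0, 0, 1, -151455690, -716756974018]`, `N = 249777 = 3³·11·29²`, X7 (additive at
`29`), `a_5 = 0`, mod-`5` image `5Nn` (k3-c4 census; no CM elliptic-curve partner), analytic rank `0`, `#tors = 1`, `∏c = 10`, `#Ш_an = 4`,
`L(E,1)/Ω_E = 40`; ONE multiplicative prime `q = 11`, `ord_q(Δ) = 5`, SPLIT): `ClassX7 W 5 ∧ ∀ ε, KobayashiLowerDivisibility W 5 ε` from print BY NAME
(`hJ h12 h41 hK13 hK08 h5 h3 hmod hGZK`) + displayed `r_an = 0` (`hr`), `¬ Surj W 5` (`hs`) and TWO displayed two-engine Mazur–Tate rows of kit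
j335262 (`LAYERS.tsv` rows `249777l1@5`: index 2, even, `μ = 0, λ = 6 = 4 + 2` ⇒ `hrowE`; index 1, odd, `μ = 0, λ = 2 = 0 + 2` ⇒ `hrowO`;
engines B and E AGREE) ⇒ `(μ, λ)(L^±_5) = (0, 2)`. Kernel-decided: `5 ∤ Δ`, `#Ẽ(𝔽_5) = 6` (`card_t249777l1_5`), `29 ∣ Δ, c₄` (X7), and the split
certificate at `q = 11`: `q ∣ Δ`, `q ∤ c₄`, node-tangent root `t = 4` (`hasSplitMultiplicativeReductionAtPrime_of_natRoot`). Per pair;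
CONDITIONAL; nothing booked. [cite: Kobayashi2003, Conjecture (p. 2), Thm. 1.2, Thm. 4.1] [cite: KimBD2008MRL, Thm. 3.12 (p. 93)]
[cite: BDKim2013, Cor. 3.15 (p. 199)] [cite: Pollack2003, Prop. 6.18] [cite: SilvermanAEC2009, VII.5 Prop. 5.1(b)]
[cite: Cremona2006, Table 1 (Cremona label 249777l1)] -/
theorem forall_kobayashiLowerDivisibility_t249777l1_5_of_split_of_mazurTateRows
    (hJ : thm62_63_73_signedColemanKato_zetaJoint) (h12 : thm12_signedSelmerDual_finite_torsion)
    (h41 : thm41_signedCharIdeal_divisibility) (hK13 : BDKim2013.cor315_signedCharValue_rankZero)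
    (hK08 : Kim2008.thm312_signedSelmerDual_charIdeal_map_invol)
    (h5 : realPeriodRat_eq_unit_mul_plusPeriod) (h3 : realPeriodRat_eq_unit_mul_plusPeriod_three)
    (hmod : exists_isNewformOf) (hGZK : rank_eq_analyticRank_of_analyticRank_le_one)
    (W : WeierstrassCurve ℚ) [W.IsElliptic] [W.IsGloballyMinimal] [Fact (Nat.Prime 5)] (hW : W = ⟨0, 0, 1, -151455690, -716756974018⟩)
    (hs : ¬ Surj W 5) (hr : W.analyticRank = 0)
    (hrowE : ∀ [NeZero (W.conductorNorm ℤ)] (f : CuspForm (Gamma0 (W.conductorNorm ℤ)) 2), IsNewformOf W f →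
      ∃ Θ : IwasawaAlgebra 5, iwasawaToPowerSeries 5 Θ =
          ((mazurTateElement f 5 2).map (algebraMap ℚ ℚ_[5]) : PowerSeries ℚ_[5]) ∧
        Θ ≠ 0 ∧ mu Θ = 0 ∧ lam Θ = (cyclotomicOmegaMinus 5 2).natDegree + 2)
    (hrowO : ∀ [NeZero (W.conductorNorm ℤ)] (f : CuspForm (Gamma0 (W.conductorNorm ℤ)) 2), IsNewformOf W f →
      ∃ Θ : IwasawaAlgebra 5, iwasawaToPowerSeries 5 Θ =
          ((mazurTateElement f 5 1).map (algebraMap ℚ ℚ_[5]) : PowerSeries ℚ_[5]) ∧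
        Θ ≠ 0 ∧ mu Θ = 0 ∧ lam Θ = (cyclotomicOmegaPlus 5 1).natDegree + 2) :
    ClassX7 W 5 ∧ ∀ ε : ℤˣ, KobayashiLowerDivisibility W 5 ε := by
  have hIW : integralModelInt W = ⟨0, 0, 1, -151455690, -716756974018⟩ :=
    integralModelInt_eq_of_map_eq _ (by rw [hW]; ext <;> simp [WeierstrassCurve.map])
  have hΔ : (⟨0, 0, 1, -151455690, -716756974018⟩ : WeierstrassCurve ℤ).Δ = discOf [0, 0, 1, -151455690, -716756974018] :=
    intCurve_Δ 0 0 1 (-151455690) (-716756974018)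
  have hc₄ : (⟨0, 0, 1, -151455690, -716756974018⟩ : WeierstrassCurve ℤ).c₄ = c4Of [0, 0, 1, -151455690, -716756974018] :=
    intCurve_c₄ 0 0 1 (-151455690) (-716756974018)
  have hgood : W.HasGoodReductionAtPrime 5 :=
    hasGoodReductionAtPrime_of_not_dvd W 5 (by rw [minimalDiscriminantInt_eq hIW, hΔ]; decide +kernel)
  have hap : W.frobeniusTrace 5 = 0 := by rw [frobeniusTrace_eq hIW card_t249777l1_5]; norm_num
  have hX : ClassX7 W 5 :=
    ⟨⟨hgood, by rw [hap]; exact dvd_zero _⟩, not_semistable_of_intModel hIW 29 (by norm_num) (by rw [hΔ]; decide +kernel)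
      (by rw [hc₄]; decide +kernel)⟩
  haveI : Fact (Nat.Prime 11) := ⟨by norm_num⟩
  have hsplit : W.HasSplitMultiplicativeReductionAtPrime 11 :=
    EisensteinPrimesMazurMCOnCellBKernelCertP13TwoUnits.hasSplitMultiplicativeReductionAtPrime_of_natRoot W hIW 11
      (by decide +kernel) (by decide +kernel) 4 (by decide +kernel)
  exact classX7_and_forall_kobayashiLowerDivisibility_of_split_of_mazurTateRows W 5 hJ h12 h41 hK13 hK08 h5 h3 hmod hGZK
    (by norm_num) hX hap hs hr (by decide) hrowE (by decide) hrowO hsplit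

/-- **Crux L's body at the tier-T2 pair `269059r1 @ 5` by the SPLIT CLOSER — NO partner** (Cremona model `[0, 0, 1, -16163770, -25012514116]`, `N = 269059 = 7²·17²·19`, X7 (additive at
`17`), `a_5 = 0`, mod-`5` image `5Nn` (k3-c4 census; no CM elliptic-curve partner), analytic rank `0`, `#tors = 1`, `∏c = 30`, `#Ш_an = 1`,
`L(E,1)/Ω_E = 30`; ONE multiplicative prime `q = 19`, `ord_q(Δ) = 5`, SPLIT): `ClassX7 W 5 ∧ ∀ ε, KobayashiLowerDivisibility W 5 ε` from print BY NAME
(`hJ h12 h41 hK13 hK08 h5 h3 hmod hGZK`) + displayed `r_an = 0` (`hr`), `¬ Surj W 5` (`hs`) and TWO displayed two-engine Mazur–Tate rows of kit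
j335262 (`LAYERS.tsv` rows `269059r1@5`: index 2, even, `μ = 0, λ = 6 = 4 + 2` ⇒ `hrowE`; index 1, odd, `μ = 0, λ = 2 = 0 + 2` ⇒ `hrowO`;
engines B and E AGREE) ⇒ `(μ, λ)(L^±_5) = (0, 2)`. Kernel-decided: `5 ∤ Δ`, `#Ẽ(𝔽_5) = 6` (`card_t269059r1_5`), `17 ∣ Δ, c₄` (X7), and the split
certificate at `q = 19`: `q ∣ Δ`, `q ∤ c₄`, node-tangent root `t = 6` (`hasSplitMultiplicativeReductionAtPrime_of_natRoot`). Per pair;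
CONDITIONAL; nothing booked. [cite: Kobayashi2003, Conjecture (p. 2), Thm. 1.2, Thm. 4.1] [cite: KimBD2008MRL, Thm. 3.12 (p. 93)]
[cite: BDKim2013, Cor. 3.15 (p. 199)] [cite: Pollack2003, Prop. 6.18] [cite: SilvermanAEC2009, VII.5 Prop. 5.1(b)]
[cite: Cremona2006, Table 1 (Cremona label 269059r1)] -/
theorem forall_kobayashiLowerDivisibility_t269059r1_5_of_split_of_mazurTateRows
    (hJ : thm62_63_73_signedColemanKato_zetaJoint) (h12 : thm12_signedSelmerDual_finite_torsion)
    (h41 : thm41_signedCharIdeal_divisibility) (hK13 : BDKim2013.cor315_signedCharValue_rankZero)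
    (hK08 : Kim2008.thm312_signedSelmerDual_charIdeal_map_invol)
    (h5 : realPeriodRat_eq_unit_mul_plusPeriod) (h3 : realPeriodRat_eq_unit_mul_plusPeriod_three)
    (hmod : exists_isNewformOf) (hGZK : rank_eq_analyticRank_of_analyticRank_le_one)
    (W : WeierstrassCurve ℚ) [W.IsElliptic] [W.IsGloballyMinimal] [Fact (Nat.Prime 5)] (hW : W = ⟨0, 0, 1, -16163770, -25012514116⟩)
    (hs : ¬ Surj W 5) (hr : W.analyticRank = 0)
    (hrowE : ∀ [NeZero (W.conductorNorm ℤ)] (f : CuspForm (Gamma0 (W.conductorNorm ℤ)) 2), IsNewformOf W f →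
      ∃ Θ : IwasawaAlgebra 5, iwasawaToPowerSeries 5 Θ =
          ((mazurTateElement f 5 2).map (algebraMap ℚ ℚ_[5]) : PowerSeries ℚ_[5]) ∧
        Θ ≠ 0 ∧ mu Θ = 0 ∧ lam Θ = (cyclotomicOmegaMinus 5 2).natDegree + 2)
    (hrowO : ∀ [NeZero (W.conductorNorm ℤ)] (f : CuspForm (Gamma0 (W.conductorNorm ℤ)) 2), IsNewformOf W f →
      ∃ Θ : IwasawaAlgebra 5, iwasawaToPowerSeries 5 Θ =
          ((mazurTateElement f 5 1).map (algebraMap ℚ ℚ_[5]) : PowerSeries ℚ_[5]) ∧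
        Θ ≠ 0 ∧ mu Θ = 0 ∧ lam Θ = (cyclotomicOmegaPlus 5 1).natDegree + 2) :
    ClassX7 W 5 ∧ ∀ ε : ℤˣ, KobayashiLowerDivisibility W 5 ε := by
  have hIW : integralModelInt W = ⟨0, 0, 1, -16163770, -25012514116⟩ :=
    integralModelInt_eq_of_map_eq _ (by rw [hW]; ext <;> simp [WeierstrassCurve.map])
  have hΔ : (⟨0, 0, 1, -16163770, -25012514116⟩ : WeierstrassCurve ℤ).Δ = discOf [0, 0, 1, -16163770, -25012514116] :=
    intCurve_Δ 0 0 1 (-16163770) (-25012514116)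
  have hc₄ : (⟨0, 0, 1, -16163770, -25012514116⟩ : WeierstrassCurve ℤ).c₄ = c4Of [0, 0, 1, -16163770, -25012514116] :=
    intCurve_c₄ 0 0 1 (-16163770) (-25012514116)
  have hgood : W.HasGoodReductionAtPrime 5 :=
    hasGoodReductionAtPrime_of_not_dvd W 5 (by rw [minimalDiscriminantInt_eq hIW, hΔ]; decide +kernel)
  have hap : W.frobeniusTrace 5 = 0 := by rw [frobeniusTrace_eq hIW card_t269059r1_5]; norm_num
  have hX : ClassX7 W 5 :=
    ⟨⟨hgood, by rw [hap]; exact dvd_zero _⟩, not_semistable_of_intModel hIW 17 (by norm_num) (by rw [hΔ]; decide +kernel)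
      (by rw [hc₄]; decide +kernel)⟩
  haveI : Fact (Nat.Prime 19) := ⟨by norm_num⟩
  have hsplit : W.HasSplitMultiplicativeReductionAtPrime 19 :=
    EisensteinPrimesMazurMCOnCellBKernelCertP13TwoUnits.hasSplitMultiplicativeReductionAtPrime_of_natRoot W hIW 19
      (by decide +kernel) (by decide +kernel) 6 (by decide +kernel)
  exact classX7_and_forall_kobayashiLowerDivisibility_of_split_of_mazurTateRows W 5 hJ h12 h41 hK13 hK08 h5 h3 hmod hGZK
    (by norm_num) hX hap hs hr (by decide) hrowE (by decide) hrowO hsplit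

/-- **Crux L's body at the tier-T2 pair `301824bp1 @ 5` by the SPLIT CLOSER — NO partner** (Cremona model `[0, 0, 0, -519960, 151523264]`, `N = 301824 = 2⁸·3²·131`, X7 (additive at
`3`), `a_5 = 0`, mod-`5` image `5Nn` (k3-c4 census; no CM elliptic-curve partner), analytic rank `0`, `#tors = 1`, `∏c = 20`, `#Ш_an = 1`,
`L(E,1)/Ω_E = 20`; ONE multiplicative prime `q = 131`, `ord_q(Δ) = 5`, SPLIT): `ClassX7 W 5 ∧ ∀ ε, KobayashiLowerDivisibility W 5 ε` from print BY NAME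
(`hJ h12 h41 hK13 hK08 h5 h3 hmod hGZK`) + displayed `r_an = 0` (`hr`), `¬ Surj W 5` (`hs`) and TWO displayed two-engine Mazur–Tate rows of kit
j335262 (`LAYERS.tsv` rows `301824bp1@5`: index 2, even, `μ = 0, λ = 6 = 4 + 2` ⇒ `hrowE`; index 1, odd, `μ = 0, λ = 2 = 0 + 2` ⇒ `hrowO`;
engines B and E AGREE) ⇒ `(μ, λ)(L^±_5) = (0, 2)`. Kernel-decided: `5 ∤ Δ`, `#Ẽ(𝔽_5) = 6` (`SmallImageCongruenceRoad.card_lam25_301824bp1_5`), `3 ∣ Δ, c₄` (X7), and the split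
certificate at `q = 131`: `q ∣ Δ`, `q ∤ c₄`, node-tangent root `t = 45` (`hasSplitMultiplicativeReductionAtPrime_of_natRoot`). Per pair;
CONDITIONAL; nothing booked. [cite: Kobayashi2003, Conjecture (p. 2), Thm. 1.2, Thm. 4.1] [cite: KimBD2008MRL, Thm. 3.12 (p. 93)]
[cite: BDKim2013, Cor. 3.15 (p. 199)] [cite: Pollack2003, Prop. 6.18] [cite: SilvermanAEC2009, VII.5 Prop. 5.1(b)]
[cite: Cremona2006, Table 1 (Cremona label 301824bp1)] -/
theorem forall_kobayashiLowerDivisibility_t301824bp1_5_of_split_of_mazurTateRows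
    (hJ : thm62_63_73_signedColemanKato_zetaJoint) (h12 : thm12_signedSelmerDual_finite_torsion)
    (h41 : thm41_signedCharIdeal_divisibility) (hK13 : BDKim2013.cor315_signedCharValue_rankZero)
    (hK08 : Kim2008.thm312_signedSelmerDual_charIdeal_map_invol)
    (h5 : realPeriodRat_eq_unit_mul_plusPeriod) (h3 : realPeriodRat_eq_unit_mul_plusPeriod_three)
    (hmod : exists_isNewformOf) (hGZK : rank_eq_analyticRank_of_analyticRank_le_one)
    (W : WeierstrassCurve ℚ) [W.IsElliptic] [W.IsGloballyMinimal] [Fact (Nat.Prime 5)] (hW : W = ⟨0, 0, 0, -519960, 151523264⟩)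
    (hs : ¬ Surj W 5) (hr : W.analyticRank = 0)
    (hrowE : ∀ [NeZero (W.conductorNorm ℤ)] (f : CuspForm (Gamma0 (W.conductorNorm ℤ)) 2), IsNewformOf W f →
      ∃ Θ : IwasawaAlgebra 5, iwasawaToPowerSeries 5 Θ =
          ((mazurTateElement f 5 2).map (algebraMap ℚ ℚ_[5]) : PowerSeries ℚ_[5]) ∧
        Θ ≠ 0 ∧ mu Θ = 0 ∧ lam Θ = (cyclotomicOmegaMinus 5 2).natDegree + 2)
    (hrowO : ∀ [NeZero (W.conductorNorm ℤ)] (f : CuspForm (Gamma0 (W.conductorNorm ℤ)) 2), IsNewformOf W f →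
      ∃ Θ : IwasawaAlgebra 5, iwasawaToPowerSeries 5 Θ =
          ((mazurTateElement f 5 1).map (algebraMap ℚ ℚ_[5]) : PowerSeries ℚ_[5]) ∧
        Θ ≠ 0 ∧ mu Θ = 0 ∧ lam Θ = (cyclotomicOmegaPlus 5 1).natDegree + 2) :
    ClassX7 W 5 ∧ ∀ ε : ℤˣ, KobayashiLowerDivisibility W 5 ε := by
  have hIW : integralModelInt W = ⟨0, 0, 0, -519960, 151523264⟩ :=
    integralModelInt_eq_of_map_eq _ (by rw [hW]; ext <;> simp [WeierstrassCurve.map])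
  have hΔ : (⟨0, 0, 0, -519960, 151523264⟩ : WeierstrassCurve ℤ).Δ = discOf [0, 0, 0, -519960, 151523264] :=
    intCurve_Δ 0 0 0 (-519960) 151523264
  have hc₄ : (⟨0, 0, 0, -519960, 151523264⟩ : WeierstrassCurve ℤ).c₄ = c4Of [0, 0, 0, -519960, 151523264] :=
    intCurve_c₄ 0 0 0 (-519960) 151523264
  have hgood : W.HasGoodReductionAtPrime 5 :=
    hasGoodReductionAtPrime_of_not_dvd W 5 (by rw [minimalDiscriminantInt_eq hIW, hΔ]; decide +kernel)
  have hap : W.frobeniusTrace 5 = 0 := by rw [frobeniusTrace_eq hIW SmallImageCongruenceRoad.card_lam25_301824bp1_5]; norm_num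
  have hX : ClassX7 W 5 :=
    ⟨⟨hgood, by rw [hap]; exact dvd_zero _⟩, not_semistable_of_intModel hIW 3 (by norm_num) (by rw [hΔ]; decide +kernel)
      (by rw [hc₄]; decide +kernel)⟩
  haveI : Fact (Nat.Prime 131) := ⟨by norm_num⟩
  have hsplit : W.HasSplitMultiplicativeReductionAtPrime 131 :=
    EisensteinPrimesMazurMCOnCellBKernelCertP13TwoUnits.hasSplitMultiplicativeReductionAtPrime_of_natRoot W hIW 131
      (by decide +kernel) (by decide +kernel) 45 (by decide +kernel)
  exact classX7_and_forall_kobayashiLowerDivisibility_of_split_of_mazurTateRows W 5 hJ h12 h41 hK13 hK08 h5 h3 hmod hGZK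
    (by norm_num) hX hap hs hr (by decide) hrowE (by decide) hrowO hsplit

end Summit.BirchSwinnertonDyer.BirchSwinnertonDyer.Theorems.SmallImageRttOneSided

end
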